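import Literature.NumberTheory.IwasawaTheory.ClassicalMuVanishesSplitCartanImage
import Literature.NumberTheory.IwasawaTheory.ClassicalMuVanishesNonsplitCartanImage
import Literature.NumberTheory.EllipticCurves.DivisionField
import HarnessLib

set_option autoImplicit false

/-!
# `μ = 0` for the cyclotomic `ℤ_3`-tower of the 3-division field `ℚ(E[3])` from the mod-3 image predicates
# `HasSplitCartanNormalizerModPImage E 3` / `HasModPImageEqNonsplitCartanNormalizer E 3`, modulo Ferrero–Washington

Topic `NumberTheory/IwasawaTheory` (namespace = path).  THEOREM-ONLY file (no definition, no named fact, no `sorry`); literature seat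
`bsd-potss-conjA-anchor` g11 (supports stmt-BirchSwinnertonDyer-19386 / 19413; closes nothing).  This is the `ℚ(E[3])`-level end of the
chain `KurodaRelationOddPart → ClassicalMuVanishesKurodaTower → ClassicalMuVanishes{Split,Nonsplit}CartanImage`: the hypothesis
«`∀ κL : ZpExtension (E.divisionField 3) 3, κL.IsCyclotomic → ClassicalMuVanishes κL`» of road (b)
(`CoatesSujatha2005.thm34_fineSelmerDual_moduleFinite_of_classicalMuVanishes_divisionField`) from
* the tree's mod-`3` image predicate (`SerreUniformity.HasSplitCartanNormalizerModPImage E 3`, resp.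
  `HasModPImageEqNonsplitCartanNormalizer E 3`),
* an element `τ ∈ Γ_ℚ` acting on `E[3]` as an involution `≠ 1, −1` (the involution fixing a chosen `P ∈ E[3] ∖ 0`; in the non-split case
  also `τ₋ ∈ Γ_ℚ` acting as `−1`), in the style of `DivisionField.not_dvd_classNumber_divisionField_of_involutions`,
* «`μ = 0` for every cyclotomic `ℤ_3`-extension» of the fixed field of `τ|_{ℚ(E[3])}` (`= ℚ(P)`; non-split case: also of the fixed field of
  `⟨τ, τ₋⟩|_{ℚ(E[3])}` `= ℚ(x(P))`, or Iwasawa's growth theorem instead),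
* `ferreroWashington1979_classicalMuVanishes`.
Ingredient: `exists_matrixRep_divisionField` — the faithful matrix representation `Gal(ℚ(E[n])/ℚ) ↪ M₂(ℤ/n)` attached to a basis
`e : E[n] ≃ (ℤ/n)²` (Shimura §19.1 / Serre 1972 §4), as an existence statement.

References: [Serre1972, §2.2, §4.1]; [SilvermanAEC2009, III.§7, VIII.§1]; [Lemmermeyer1994, §1]; [Washington1997, §7.5, §13.1].
-/

noncomputable section

open scoped NumberField Matrix

open Field IntermediateField WeierstrassCurve Literature.NumberTheory.EllipticCurves Literature.NumberTheory.GaloisRepresentations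
  Literature.NumberTheory.SerreUniformity

namespace Literature.NumberTheory.IwasawaTheory

/-! ### §1 The matrix representation of `Gal(ℚ(E[n])/ℚ)` attached to a basis of `E[n]` -/

/-- `Γ_ℚ → Gal(ℚ(E[n])/ℚ)` is onto (Mathlib `AlgEquiv.restrictNormalHom_surjective`). [folklore] -/
private theorem absRestrictNormalHom_surjective_dF {F : Type*} [Field F] (E : IntermediateField F (AlgebraicClosure F))
    [Normal F E] : Function.Surjective (absRestrictNormalHom E) := fun g => by
  obtain ⟨σ, hσ⟩ := AlgEquiv.restrictNormalHom_surjective (AlgebraicClosure F) g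
  exact ⟨(absoluteGaloisGroup.toAlgEquiv F).symm σ, hσ⟩

/-- Two matrices with the same action on the vectors `e P` (`e` a bijection onto `(ℤ/n)²`) are equal. [folklore] -/
private theorem matrix_eq_of_forall_mulVec {A : Type*} [AddCommGroup A] {n : ℕ} (e : A ≃+ (Fin 2 → ZMod n))
    {M N : Matrix (Fin 2) (Fin 2) (ZMod n)} (h : ∀ P : A, M *ᵥ e P = N *ᵥ e P) : M = N :=
  Matrix.toLin'.injective (LinearMap.ext fun v => by
    rw [Matrix.toLin'_apply, Matrix.toLin'_apply, ← e.apply_symm_apply v, h])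

/-- **The faithful representation `Gal(ℚ(E[n])/ℚ) ↪ M₂(ℤ/n)` attached to a basis `e` of `E[n]`** (`E` elliptic, `n ≠ 0`): there is an
injective monoid hom `ρ` with `e(σ • P) = ρ(σ|_{ℚ(E[n])}) · e(P)` for all `σ ∈ Γ_ℚ`, `P ∈ E[n]` — the matrix of `σ` in the basis `e`,
descended along `Γ_ℚ ↠ Gal(ℚ(E[n])/ℚ)`, whose kernel is the pointwise stabiliser of `E[n]`
(`absRestrictNormalHom_divisionField_eq_one_iff`). [cite: SilvermanAEC2009, III.§7 (the representation on E[m]), VIII.§1]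
[cite: Serre1972, §4.1 (the Galois module E_n and G_n ⊂ GL₂(ℤ/n))] -/
theorem exists_matrixRep_divisionField {K : Type} [Field K] [CharZero K] (W : WeierstrassCurve K) [W.IsElliptic] (n : ℕ)
    [NeZero n] (e : W.geomTorsion n ≃+ (Fin 2 → ZMod n)) :
    ∃ ρ : (↥(W.divisionField n) ≃ₐ[K] ↥(W.divisionField n)) →* Matrix (Fin 2) (Fin 2) (ZMod n), Function.Injective ρ ∧
      ∀ (σ : absoluteGaloisGroup K) (P : W.geomTorsion n), e (σ • P) = ρ (absRestrictNormalHom (W.divisionField n) σ) *ᵥ e P := by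
  classical
  let Λ : absoluteGaloisGroup K → ((Fin 2 → ZMod n) →ₗ[ZMod n] (Fin 2 → ZMod n)) := fun σ =>
    (e.toAddMonoidHom.comp ((DistribSMul.toAddMonoidHom (W.geomTorsion n) σ).comp e.symm.toAddMonoidHom)).toZModLinearMap n
  have hΛ : ∀ σ v, Λ σ v = e (σ • e.symm v) := fun σ v => rfl
  let ρ₀ : absoluteGaloisGroup K →* Matrix (Fin 2) (Fin 2) (ZMod n) :=
    { toFun := fun σ => LinearMap.toMatrix' (Λ σ)
      map_one' := by
        have h : Λ 1 = LinearMap.id := LinearMap.ext fun v => by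
          rw [hΛ, one_smul, AddEquiv.apply_symm_apply, LinearMap.id_apply]
        simp only [h, LinearMap.toMatrix'_id]
      map_mul' := fun σ τ => by
        have h : Λ (σ * τ) = (Λ σ).comp (Λ τ) := LinearMap.ext fun v => by
          rw [LinearMap.comp_apply, hΛ, hΛ, hΛ, mul_smul, AddEquiv.symm_apply_apply]
        simp only [h, LinearMap.toMatrix'_comp] }
  have hρ₀ : ∀ σ (P : W.geomTorsion n), e (σ • P) = ρ₀ σ *ᵥ e P := fun σ P => by
    show e (σ • P) = LinearMap.toMatrix' (Λ σ) *ᵥ e P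
    rw [LinearMap.toMatrix'_mulVec, hΛ, AddEquiv.symm_apply_apply]
  have hker₀ : ∀ σ, ρ₀ σ = 1 → absRestrictNormalHom (W.divisionField n) σ = 1 := fun σ h => by
    rw [W.absRestrictNormalHom_divisionField_eq_one_iff n σ]
    intro T
    apply e.injective
    rw [hρ₀, h, Matrix.one_mulVec]
  have hker₀' : ∀ σ, absRestrictNormalHom (W.divisionField n) σ = 1 → ρ₀ σ = 1 := fun σ h => by
    rw [W.absRestrictNormalHom_divisionField_eq_one_iff n σ] at h
    have hid : Λ σ = LinearMap.id := LinearMap.ext fun v => by rw [hΛ, h, AddEquiv.apply_symm_apply, LinearMap.id_apply]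
    show LinearMap.toMatrix' (Λ σ) = 1
    rw [hid, LinearMap.toMatrix'_id]
  have hπ := absRestrictNormalHom_surjective_dF (W.divisionField n)
  have hk : (absRestrictNormalHom (W.divisionField n)).ker ≤ ρ₀.toHomUnits.ker := fun σ hσ => by
    rw [MonoidHom.mem_ker] at hσ ⊢
    exact Units.ext (hker₀' σ hσ)
  refine ⟨(Units.coeHom _).comp ((absRestrictNormalHom (W.divisionField n)).liftOfSurjective hπ ⟨ρ₀.toHomUnits, hk⟩), ?_,
    fun σ P => ?_⟩
  · rw [injective_iff_map_eq_one]
    intro g hg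
    obtain ⟨σ, rfl⟩ := hπ g
    rw [MonoidHom.comp_apply, MonoidHom.liftOfRightInverse_comp_apply] at hg
    exact hker₀ σ (by simpa using hg)
  · rw [MonoidHom.comp_apply, MonoidHom.liftOfRightInverse_comp_apply]
    exact hρ₀ σ P

/-! ### §2 The bridges for an arbitrary `ℚ`-algebra structure (`ℚ(E[3]) ⊆ ℚ̄` carries the subfield one) -/

/-- `…_splitCartanNormalizer_three_fixedField` for any `ℚ`-algebra structure on `L` (all coincide: `Subsingleton (Algebra ℚ L)`).
[cite: Serre1972, §2.2 (split Cartan subgroups, normalisers)] [cite: Washington1997, §7.5, §13.1] -/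
private theorem split_fixedField_alg (hFW : ferreroWashington1979_classicalMuVanishes)
    (L : Type) [Field L] [NumberField L] [alg : Algebra ℚ L] [IsGalois ℚ L]
    (ρ : (L ≃ₐ[ℚ] L) →* Matrix (Fin 2) (Fin 2) (ZMod 3)) (hρ : Function.Injective ρ)
    (himg : ∀ g, ρ g ∈ splitCartanNormalizer 3)
    {s : L ≃ₐ[ℚ] L} (hss : s * s = 1) (hs1 : ρ s ≠ 1) (hs2 : ρ s ≠ -1)
    (hμ : ∀ κE : ZpExtension ↥(fixedField (Subgroup.zpowers s)) 3, κE.IsCyclotomic → ClassicalMuVanishes κE)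
    (κL : ZpExtension L 3) (hκL : κL.IsCyclotomic) : ClassicalMuVanishes κL := by
  have h : alg = DivisionRing.toRatAlgebra := Subsingleton.elim _ _
  subst h
  exact classicalMuVanishes_of_isCyclotomic_of_splitCartanNormalizer_three_fixedField hFW L ρ hρ himg hss hs1 hs2 hμ κL hκL

/-- `…_nonsplitCartanNormalizer_three_fixedField` for any `ℚ`-algebra structure on `L`. [cite: Serre1972, §2.2]
[cite: Washington1997, §7.5, §13.1] -/
private theorem nonsplit_fixedField_alg (hFW : ferreroWashington1979_classicalMuVanishes)
    (L : Type) [Field L] [NumberField L] [alg : Algebra ℚ L] [IsGalois ℚ L]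
    (ρ : (L ≃ₐ[ℚ] L) →* Matrix (Fin 2) (Fin 2) (ZMod 3)) (hρ : Function.Injective ρ) {ε : ZMod 3} (hε : ¬ IsSquare ε)
    (himg : ∀ g, ρ g ∈ nonsplitCartanNormalizer ε) (hsurj : ∀ M ∈ nonsplitCartanNormalizer ε, ∃ g, ρ g = M)
    {s : L ≃ₐ[ℚ] L} (hss : s * s = 1) (hs1 : ρ s ≠ 1) (hs2 : ρ s ≠ -1) {z : L ≃ₐ[ℚ] L} (hz : ρ z = -1)
    (hμ : ∀ κE : ZpExtension ↥(fixedField (Subgroup.zpowers s)) 3, κE.IsCyclotomic → ClassicalMuVanishes κE)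
    (hμ' : ∀ κE : ZpExtension ↥(fixedField (Subgroup.zpowers s ⊔ Subgroup.zpowers z)) 3,
      κE.IsCyclotomic → ClassicalMuVanishes κE)
    (κL : ZpExtension L 3) (hκL : κL.IsCyclotomic) : ClassicalMuVanishes κL := by
  have h : alg = DivisionRing.toRatAlgebra := Subsingleton.elim _ _
  subst h
  exact classicalMuVanishes_of_isCyclotomic_of_nonsplitCartanNormalizer_three_fixedField hFW L ρ hρ hε himg hsurj hss hs1 hs2 hz
    hμ hμ' κL hκL

/-- `…_nonsplitCartanNormalizer_three_fixedField'` for any `ℚ`-algebra structure on `L`. [cite: Serre1972, §2.2]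
[cite: Washington1997, §7.5, §13.1] -/
private theorem nonsplit_fixedField_alg' (hI : iwasawa1959_classNumberPExp_growth) (hFW : ferreroWashington1979_classicalMuVanishes)
    (L : Type) [Field L] [NumberField L] [alg : Algebra ℚ L] [IsGalois ℚ L]
    (ρ : (L ≃ₐ[ℚ] L) →* Matrix (Fin 2) (Fin 2) (ZMod 3)) (hρ : Function.Injective ρ) {ε : ZMod 3} (hε : ¬ IsSquare ε)
    (himg : ∀ g, ρ g ∈ nonsplitCartanNormalizer ε) (hsurj : ∀ M ∈ nonsplitCartanNormalizer ε, ∃ g, ρ g = M)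
    {s : L ≃ₐ[ℚ] L} (hss : s * s = 1) (hs1 : ρ s ≠ 1) (hs2 : ρ s ≠ -1)
    (hμ : ∀ κE : ZpExtension ↥(fixedField (Subgroup.zpowers s)) 3, κE.IsCyclotomic → ClassicalMuVanishes κE)
    (κL : ZpExtension L 3) (hκL : κL.IsCyclotomic) : ClassicalMuVanishes κL := by
  have h : alg = DivisionRing.toRatAlgebra := Subsingleton.elim _ _
  subst h
  exact classicalMuVanishes_of_isCyclotomic_of_nonsplitCartanNormalizer_three_fixedField' hI hFW L ρ hρ hε himg hsurj hss hs1 hs2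
    hμ κL hκL

/-! ### §3 `μ = 0` for `ℚ(E[3])_cyc` from the image predicates -/

/-- **Split Cartan image (`D₄` road), modulo Ferrero–Washington alone.**  `E/ℚ` elliptic with mod-`3` image contained in the
normaliser of a split Cartan subgroup (`HasSplitCartanNormalizerModPImage E 3`); `τ ∈ Γ_ℚ` acting on `E[3]` as an involution which is
neither `1` nor `−1` (the involution of `Stab(P)` for a `P ∈ E[3] ∖ 0` when the image is all of `C_s⁺(3)`; then the fixed field of
`τ|_{ℚ(E[3])}` is `ℚ(P)`).  If `μ = 0` holds for every cyclotomic `ℤ_3`-extension of the fixed field of `τ|_{ℚ(E[3])}`, then — under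
`ferreroWashington1979_classicalMuVanishes` — for every cyclotomic `ℤ_3`-extension of `ℚ(E[3])`: the hypothesis of road (b)
(`CoatesSujatha2005.thm34_…_classicalMuVanishes_divisionField`) at `p = 3`.  No growth theorem, no further displayed identity.
[cite: Serre1972, §2.2 (split Cartan subgroups, normalisers)] [cite: Lemmermeyer1994, §1 (Kuroda's class number formula, odd part)]
[cite: Washington1997, §7.5, §13.1] -/
theorem classicalMuVanishes_divisionField_of_hasSplitCartanNormalizerModPImage_three
    (hFW : ferreroWashington1979_classicalMuVanishes) (W : WeierstrassCurve ℚ) [W.IsElliptic]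
    (himg : HasSplitCartanNormalizerModPImage W 3) (τ : absoluteGaloisGroup ℚ)
    (hτ2 : ∀ T : W.geomTorsion (3 : ℕ), τ • (τ • T) = T) (hτ1 : ∃ T : W.geomTorsion (3 : ℕ), τ • T ≠ T)
    (hτm : ∃ T : W.geomTorsion (3 : ℕ), τ • T ≠ -T)
    (hμ : haveI : NumberField ↥(W.divisionField 3) := NumberField.mk
      ∀ κE : ZpExtension ↥(fixedField (Subgroup.zpowers (absRestrictNormalHom (W.divisionField 3) τ))) 3,
        κE.IsCyclotomic → ClassicalMuVanishes κE) :
    haveI : NumberField ↥(W.divisionField 3) := NumberField.mk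
    ∀ κL : ZpExtension ↥(W.divisionField 3) 3, κL.IsCyclotomic → ClassicalMuVanishes κL := by
  haveI : NumberField ↥(W.divisionField 3) := NumberField.mk
  intro κL hκL
  obtain ⟨e, he⟩ := himg
  obtain ⟨ρ, hρ, hρe⟩ := exists_matrixRep_divisionField W 3 e
  have hπ := absRestrictNormalHom_surjective_dF (W.divisionField 3)
  have hmat : ∀ (σ : absoluteGaloisGroup ℚ) (M : Matrix (Fin 2) (Fin 2) (ZMod 3)),
      (∀ P : W.geomTorsion (3 : ℕ), e (σ • P) = M *ᵥ e P) → ρ (absRestrictNormalHom (W.divisionField 3) σ) = M :=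
    fun σ M hM => matrix_eq_of_forall_mulVec e fun P => by rw [← hρe, hM]
  have himg' : ∀ g, ρ g ∈ splitCartanNormalizer 3 := fun g => by
    obtain ⟨σ, rfl⟩ := hπ g
    obtain ⟨M, hM, hMe⟩ := he σ
    rw [hmat σ M hMe]
    exact hM
  have hss : absRestrictNormalHom (W.divisionField 3) τ * absRestrictNormalHom (W.divisionField 3) τ = 1 := by
    rw [← map_mul, W.absRestrictNormalHom_divisionField_eq_one_iff 3]
    intro T
    rw [mul_smul]
    exact hτ2 T
  have hs1 : ρ (absRestrictNormalHom (W.divisionField 3) τ) ≠ 1 := fun h => by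
    obtain ⟨T, hT⟩ := hτ1
    exact hT (e.injective (by rw [hρe, h, Matrix.one_mulVec]))
  have hs2 : ρ (absRestrictNormalHom (W.divisionField 3) τ) ≠ -1 := fun h => by
    obtain ⟨T, hT⟩ := hτm
    exact hT (e.injective (by rw [hρe, h, Matrix.neg_mulVec, Matrix.one_mulVec, map_neg]))
  exact @split_fixedField_alg hFW ↥(W.divisionField 3) _ _ (_) (W.isGalois_divisionField 3) ρ hρ himg' _ hss hs1 hs2 hμ κL hκL

/-- **Non-split Cartan image (`SD₁₆` road), modulo Ferrero–Washington alone.**  `E/ℚ` elliptic with mod-`3` image EQUAL to the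
normaliser of a non-split Cartan subgroup (`HasModPImageEqNonsplitCartanNormalizer E 3`); `τ ∈ Γ_ℚ` acting on `E[3]` as an involution
`≠ 1, −1` (the involution of `Stab(P)`, `P ∈ E[3] ∖ 0`: fixed field `ℚ(P)`, degree `8`) and `τ₋ ∈ Γ_ℚ` acting as `−1` (so that the fixed
field of `⟨τ, τ₋⟩|_{ℚ(E[3])}` is `ℚ(x(P))`, degree `4`).  If `μ = 0` holds for every cyclotomic `ℤ_3`-extension of both fixed fields,
then — under `ferreroWashington1979_classicalMuVanishes` — for every cyclotomic `ℤ_3`-extension of `ℚ(E[3])`.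
[cite: Serre1972, §2.2 (non-split Cartan subgroups and their normalisers)] [cite: FurioLombardo2023, (1.1), Thm. 1.5]
[cite: Lemmermeyer1994, §1 (Kuroda's class number formula, odd part)] [cite: Washington1997, §7.5, §13.1] -/
theorem classicalMuVanishes_divisionField_of_hasModPImageEqNonsplitCartanNormalizer_three
    (hFW : ferreroWashington1979_classicalMuVanishes) (W : WeierstrassCurve ℚ) [W.IsElliptic]
    (himg : HasModPImageEqNonsplitCartanNormalizer W 3) (τ τm : absoluteGaloisGroup ℚ)
    (hτ2 : ∀ T : W.geomTorsion (3 : ℕ), τ • (τ • T) = T) (hτ1 : ∃ T : W.geomTorsion (3 : ℕ), τ • T ≠ T)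
    (hτm : ∃ T : W.geomTorsion (3 : ℕ), τ • T ≠ -T) (hm : ∀ T : W.geomTorsion (3 : ℕ), τm • T = -T)
    (hμ : haveI : NumberField ↥(W.divisionField 3) := NumberField.mk
      ∀ κE : ZpExtension ↥(fixedField (Subgroup.zpowers (absRestrictNormalHom (W.divisionField 3) τ))) 3,
        κE.IsCyclotomic → ClassicalMuVanishes κE)
    (hμ' : haveI : NumberField ↥(W.divisionField 3) := NumberField.mk
      ∀ κE : ZpExtension ↥(fixedField (Subgroup.zpowers (absRestrictNormalHom (W.divisionField 3) τ) ⊔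
        Subgroup.zpowers (absRestrictNormalHom (W.divisionField 3) τm))) 3, κE.IsCyclotomic → ClassicalMuVanishes κE) :
    haveI : NumberField ↥(W.divisionField 3) := NumberField.mk
    ∀ κL : ZpExtension ↥(W.divisionField 3) 3, κL.IsCyclotomic → ClassicalMuVanishes κL := by
  haveI : NumberField ↥(W.divisionField 3) := NumberField.mk
  intro κL hκL
  obtain ⟨e, ε, hε, he, hsurjM⟩ := himg
  obtain ⟨ρ, hρ, hρe⟩ := exists_matrixRep_divisionField W 3 e
  have hπ := absRestrictNormalHom_surjective_dF (W.divisionField 3)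
  have hmat : ∀ (σ : absoluteGaloisGroup ℚ) (M : Matrix (Fin 2) (Fin 2) (ZMod 3)),
      (∀ P : W.geomTorsion (3 : ℕ), e (σ • P) = M *ᵥ e P) → ρ (absRestrictNormalHom (W.divisionField 3) σ) = M :=
    fun σ M hM => matrix_eq_of_forall_mulVec e fun P => by rw [← hρe, hM]
  have himg' : ∀ g, ρ g ∈ nonsplitCartanNormalizer ε := fun g => by
    obtain ⟨σ, rfl⟩ := hπ g
    obtain ⟨M, hM, hMe⟩ := he σ
    rw [hmat σ M hMe]
    exact hM
  have hsurj' : ∀ M ∈ nonsplitCartanNormalizer ε, ∃ g, ρ g = M := fun M hM => by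
    obtain ⟨σ, hσ⟩ := hsurjM M hM
    exact ⟨_, hmat σ M hσ⟩
  have hss : absRestrictNormalHom (W.divisionField 3) τ * absRestrictNormalHom (W.divisionField 3) τ = 1 := by
    rw [← map_mul, W.absRestrictNormalHom_divisionField_eq_one_iff 3]
    intro T
    rw [mul_smul]
    exact hτ2 T
  have hs1 : ρ (absRestrictNormalHom (W.divisionField 3) τ) ≠ 1 := fun h => by
    obtain ⟨T, hT⟩ := hτ1
    exact hT (e.injective (by rw [hρe, h, Matrix.one_mulVec]))
  have hs2 : ρ (absRestrictNormalHom (W.divisionField 3) τ) ≠ -1 := fun h => by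
    obtain ⟨T, hT⟩ := hτm
    exact hT (e.injective (by rw [hρe, h, Matrix.neg_mulVec, Matrix.one_mulVec, map_neg]))
  have hz : ρ (absRestrictNormalHom (W.divisionField 3) τm) = -1 :=
    hmat τm (-1) fun P => by rw [hm, map_neg, Matrix.neg_mulVec, Matrix.one_mulVec]
  exact @nonsplit_fixedField_alg hFW ↥(W.divisionField 3) _ _ (_) (W.isGalois_divisionField 3) ρ hρ ε hε himg' hsurj' _ hss hs1
    hs2 _ hz hμ hμ' κL hκL

/-- **Non-split Cartan image, input `ℚ(P)` alone, paying Iwasawa's growth theorem** (`…_nonsplitCartanNormalizer_three_fixedField'`).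
[cite: Serre1972, §2.2 (non-split Cartan subgroups and their normalisers)] [cite: FurioLombardo2023, Thm. 1.5]
[cite: Washington1997, §7.5, §13.1] [cite: BiasseEtAl2022, Example 2.5, Prop. 3.7] -/
theorem classicalMuVanishes_divisionField_of_hasModPImageEqNonsplitCartanNormalizer_three'
    (hI : iwasawa1959_classNumberPExp_growth) (hFW : ferreroWashington1979_classicalMuVanishes)
    (W : WeierstrassCurve ℚ) [W.IsElliptic] (himg : HasModPImageEqNonsplitCartanNormalizer W 3) (τ : absoluteGaloisGroup ℚ)
    (hτ2 : ∀ T : W.geomTorsion (3 : ℕ), τ • (τ • T) = T) (hτ1 : ∃ T : W.geomTorsion (3 : ℕ), τ • T ≠ T)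
    (hτm : ∃ T : W.geomTorsion (3 : ℕ), τ • T ≠ -T)
    (hμ : haveI : NumberField ↥(W.divisionField 3) := NumberField.mk
      ∀ κE : ZpExtension ↥(fixedField (Subgroup.zpowers (absRestrictNormalHom (W.divisionField 3) τ))) 3,
        κE.IsCyclotomic → ClassicalMuVanishes κE) :
    haveI : NumberField ↥(W.divisionField 3) := NumberField.mk
    ∀ κL : ZpExtension ↥(W.divisionField 3) 3, κL.IsCyclotomic → ClassicalMuVanishes κL := by
  haveI : NumberField ↥(W.divisionField 3) := NumberField.mk
  intro κL hκL
  obtain ⟨e, ε, hε, he, hsurjM⟩ := himg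
  obtain ⟨ρ, hρ, hρe⟩ := exists_matrixRep_divisionField W 3 e
  have hπ := absRestrictNormalHom_surjective_dF (W.divisionField 3)
  have hmat : ∀ (σ : absoluteGaloisGroup ℚ) (M : Matrix (Fin 2) (Fin 2) (ZMod 3)),
      (∀ P : W.geomTorsion (3 : ℕ), e (σ • P) = M *ᵥ e P) → ρ (absRestrictNormalHom (W.divisionField 3) σ) = M :=
    fun σ M hM => matrix_eq_of_forall_mulVec e fun P => by rw [← hρe, hM]
  have himg' : ∀ g, ρ g ∈ nonsplitCartanNormalizer ε := fun g => by
    obtain ⟨σ, rfl⟩ := hπ g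
    obtain ⟨M, hM, hMe⟩ := he σ
    rw [hmat σ M hMe]
    exact hM
  have hsurj' : ∀ M ∈ nonsplitCartanNormalizer ε, ∃ g, ρ g = M := fun M hM => by
    obtain ⟨σ, hσ⟩ := hsurjM M hM
    exact ⟨_, hmat σ M hσ⟩
  have hss : absRestrictNormalHom (W.divisionField 3) τ * absRestrictNormalHom (W.divisionField 3) τ = 1 := by
    rw [← map_mul, W.absRestrictNormalHom_divisionField_eq_one_iff 3]
    intro T
    rw [mul_smul]
    exact hτ2 T
  have hs1 : ρ (absRestrictNormalHom (W.divisionField 3) τ) ≠ 1 := fun h => by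
    obtain ⟨T, hT⟩ := hτ1
    exact hT (e.injective (by rw [hρe, h, Matrix.one_mulVec]))
  have hs2 : ρ (absRestrictNormalHom (W.divisionField 3) τ) ≠ -1 := fun h => by
    obtain ⟨T, hT⟩ := hτm
    exact hT (e.injective (by rw [hρe, h, Matrix.neg_mulVec, Matrix.one_mulVec, map_neg]))
  exact @nonsplit_fixedField_alg' hI hFW ↥(W.divisionField 3) _ _ (_) (W.isGalois_divisionField 3) ρ hρ ε hε himg' hsurj' _ hss
    hs1 hs2 hμ κL hκL

end Literature.NumberTheory.IwasawaTheory

end
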